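import Literature.NumberTheory.Automorphic.ArthurClozelLiftingIdentityHeckeCharacters
import Literature.NumberTheory.Automorphic.ArthurClozelWeakLiftingOffSProofs
import Literature.NumberTheory.Automorphic.Sweep1BaseChangeGLOne
import Literature.NumberTheory.Automorphic.BaseChangeStrongUnramifiedRankOne
import Literature.NumberTheory.Automorphic.GLOneOfHeckeCharacter
import Literature.NumberTheory.Automorphic.ClassFieldCharacterLocal
import Literature.NumberTheory.Automorphic.PairLFunctionMeromorphicContinuationRankNeTwistProofs
import HarnessLib

/-!
# Arthur–Clozel, Ch. 3, (4.1) = (4.2) in the lifting direction — proof file: the rank-one case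

Topic `NumberTheory/Automorphic`; namespace `Literature.NumberTheory.Automorphic`.  Sibling PROOF
file (theorems only, no named fact, no definition) of `ArthurClozelLiftingIdentityHeckeCharacters`,
which vends the named fact `ArthurClozel1989_liftingIdentity_heckeCharacters`: the identity
(4.1) = (4.2) of J. Arthur, L. Clozel, *Simple algebras, base change, and the advanced theory of
the trace formula*, Ann. of Math. Stud. 120 (1989), Ch. 3 (the comparison of the trace formula of
`GL_n(𝔸_F)` with the twisted trace formula of `GL_n(𝔸_E) ⋊ σ`, Ch. 2, Thms. A, B, (17.8)), started
from a cuspidal `π` of `GL_n(𝔸_F)` unramified off a prescribed finite `S`, unpacked as an identity of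
characters of the unramified Hecke algebra `ℋ_E^S` (pp. 203–205).

## Status of the named fact

For `n ≥ 2` the only printed proof of the fact is the trace-formula comparison of op. cit. Ch. 2
(invariant and twisted Arthur–Selberg trace formulae for `GL_n`, association of test functions and
the fundamental lemma for the spherical base-change morphism `b`, Ch. 1 §§3–4, Langlands'
"subquotient of induced from cuspidal", Corvallis 1979 Prop. 2), none of which has a counterpart in
Mathlib or in `Literature/` at the time of writing; the fact is kept as a vendored named fact.  This
file proves what IS in reach: the case `n = 1`, which is also the base of Arthur–Clozel's induction
on `n` (Ch. 3, §4, p. 203: "We assume all statements of Theorem 4.2 known up to `n - 1`").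

## What is proved

* `ArthurClozel1989_liftingIdentity_heckeCharacters.rank_one` — the statement of the named fact
  with `n = 1`, for every finite Galois `E/F` (primality of the degree and finiteness of `S` are not
  used).  In rank one base change is `χ ↦ χ_E = χ ∘ N_{E/F}` on idèle class characters
  (`HeckeCharacter.baseChange`, `Sweep1BaseChangeGLOne`): the cuspidal `π ⊂ L²(GL_1(F) ℝ_{>0} \ 𝕀_F)`
  is the line of its Hecke character `χ = χ_π`; the line `Π` of `χ_E` in `L²_cusp(GL_1(𝔸_E), ν 1)`
  (`CuspidalAutomorphicRepGL.exists_heckeCharacter_eq`) is unramified at every place `w` of `E` not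
  over `S` (`HeckeCharacter.isUnramifiedAt_baseChange`), with an honest Satake parameter
  `{χ_E(ϖ_w)}` there at a level prime to `w` (`HeckeCharacter.exists_level_not_dvd_of_isUnramifiedAt`,
  `GLOne.hasSatakeParameterAt_of_mem_fixedVectors`), and `χ_E(ϖ_w) = χ(ϖ_v)^{f(w|v)}` because the
  image of `ϖ_v` is a uniformizer of `E_w` (`e(w|v) = 1`) of norm `ϖ_v^{f(w|v)}`
  (`HeckeCharacter.baseChange_localUnits`) — relation (1.1) of op. cit. Ch. 3 §1 at EVERY `w ∤ S`.
  The identity of Hecke characters is then the one-term-on-each-side identity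
  `χ_{t_Π} = χ_{N(t_π)}` (`heckeCharacterIdentity_of_isobaricLiftFamily` of
  `ArthurClozelWeakLiftingOffSProofs`).

* `ArthurClozel1989_liftingIdentity_heckeCharacters_iff_forall_exists_isobaricLift` — the named
  fact is EQUIVALENT to the bare existence statement it packages: for every admissible
  `(E/F, n, μ, ν, π, S)` an isobaric weak base-change datum for `π` over `E` off `S` (cuspidal
  `Πₘ ⊂ L²_cusp(ν_{dₘ})`, `∑ dₘ = n`, shifts with `∑ dₘ sₘ = 0`, Satake families with
  `α(v)^{f(w|v)} = ⨆ₘ q_w^{-sₘ} Aₘ(w)` at every `w ∤ S`), by the two extraction theorems of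
  `ArthurClozelWeakLiftingOffSProofs`.  This pins what a discharge of the fact has to produce: weak
  base change of cuspidal representations of `GL_n(𝔸_F)` in prime degree, in isobaric form, inside
  prescribed automorphic measures, with the unramified relation at every place off `S`.

No statement of the tree is modified; no named fact is introduced (net debt delta `0`).

## References

* J. Arthur, L. Clozel, *Simple algebras, base change, and the advanced theory of the trace
  formula*, Ann. of Math. Stud. 120, Princeton University Press, 1989 — Ch. 3, §1 (1.1),
  Def. 1.1; (4.1), (4.2), Thm. 4.2 (a) and its proof, pp. 201–205 (rank one: p. 203, the base of the
  induction on `n`). [ArthurClozelAMS120]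
* J. Tate, *Fourier analysis in number fields and Hecke's zeta-functions* (1950), §2.5, in
  Cassels–Fröhlich (1967), Ch. XV. [TateThesis1967]
-/

noncomputable section

open scoped MatrixGroups
open NumberField IsDedekindDomain _root_.MeasureTheory Filter

namespace Literature.NumberTheory.Automorphic

open AdelicGroupData
open Literature.NumberTheory.GaloisRepresentations (HeckeCharacter localUnits)

/-- **Arthur–Clozel 1989, Ch. 3, (4.1) = (4.2) in the lifting direction, rank one (PROVED).**  The
statement of the named fact `ArthurClozel1989_liftingIdentity_heckeCharacters` with `n = 1`: for a
finite Galois `E/F`, an automorphic measure `μ` on `GL_1(𝔸_F) ⧸ ℝ_{>0} Fˣ`, a family `ν_a` of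
automorphic measures over `E`, a cuspidal `π ⊂ L²(μ)` and a set `S` of finite places of `F` off
which `E/F` and `π` are unramified, the isobaric datum "`Π =` the line of `χ_π ∘ N_{E/F}` in
`L²_cusp(GL_1(𝔸_E), ν 1)`, shift `0`, Satake family `w ↦ {χ_π(N ϖ_w)}`" and the single family
`B₀ = N(t_π) : w ↦ {χ_π(ϖ_v)^{f(w|v)}}` with coefficient `1` satisfy the identity of Hecke
characters, because `{χ_π(N ϖ_w)} = {χ_π(ϖ_v)^{f(w|v)}}` at every `w ∤ S` — relation (1.1) of
op. cit. Ch. 3 §1 for `GL(1)`, i.e. base change `χ ↦ χ ∘ N_{E/F}` of idèle class characters, the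
case `n = 1` with which Arthur–Clozel's induction on `n` starts (p. 203).  The degree of `E/F` need
not be prime and `S` need not be finite here.
[cite: ArthurClozelAMS120, Ch. 3, §1 (1.1) and proof of Thm. 4.2 (a), p. 203 (base of the induction)] -/
theorem ArthurClozel1989_liftingIdentity_heckeCharacters.rank_one :
    ∀ {F E : Type} [Field F] [NumberField F] [Field E] [NumberField E]
      [Algebra F E] [IsGalois F E], (Module.finrank F E).Prime → 0 < 1 →
      ∀ (μ : Measure (gl 1 F).automorphicQuotient) [(gl 1 F).IsAutomorphicMeasure μ]
        (P : CuspidalAutomorphicRepGL 1 F μ)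
        (ν : (a : ℕ) → Measure (gl a E).automorphicQuotient)
        [∀ a, (gl a E).IsAutomorphicMeasure (ν a)]
        (S : Set (HeightOneSpectrum (𝓞 F))), S.Finite →
        (∀ v ∉ S, Algebra.IsUnramifiedIn (𝓞 E) v.asIdeal) →
        (∀ v ∉ S, IsUnramifiedAt P.1 v) →
        ∃ (a : ℕ) (c : Fin a → ℂ) (r : Fin a → ℕ) (k : (i : Fin a) → Fin (r i) → ℕ)
          (_ : ∀ i m, 0 < k i m) (_ : ∀ i, ∑ m, k i m = 1)
          (Q : (i : Fin a) → (m : Fin (r i)) → CuspidalAutomorphicRepGL (k i m) E (ν (k i m)))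
          (s : (i : Fin a) → Fin (r i) → ℂ) (_ : ∀ i, ∑ m, (k i m : ℂ) * s i m = 0)
          (A : (i : Fin a) → Fin (r i) → SatakeFamily E)
          (_ : ∀ i m, IsSatakeFamilyOf (Q i m) {w | w.under (𝓞 F) ∈ S} (A i m))
          (b : ℕ) (d : Fin b → ℂ) (B : Fin b → SatakeFamily E)
          (_ : ∀ j, ∀ w ∉ {w : HeightOneSpectrum (𝓞 E) | w.under (𝓞 F) ∈ S},
            Multiset.card (B j w) = 1)
          (_ : ∀ j j', (∀ w ∉ {w : HeightOneSpectrum (𝓞 E) | w.under (𝓞 F) ∈ S}, B j w = B j' w) →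
            j = j')
          (j₀ : Fin b) (_ : d j₀ ≠ 0)
          (α : SatakeFamily F) (_ : IsSatakeFamilyOf P S α)
          (_ : ∀ w ∉ {w : HeightOneSpectrum (𝓞 E) | w.under (𝓞 F) ∈ S},
            B j₀ w = (α (w.under (𝓞 F))).map (· ^ w.asIdeal.inertiaDeg (𝓞 F))),
          ∀ φ : MvPolynomial
              ({w : HeightOneSpectrum (𝓞 E) //
                  w ∉ {w : HeightOneSpectrum (𝓞 E) | w.under (𝓞 F) ∈ S}} × Fin 1) ℂ,
            ∑ i, c i * MvPolynomial.eval
                (fun p : {w : HeightOneSpectrum (𝓞 E) //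
                    w ∉ {w : HeightOneSpectrum (𝓞 E) | w.under (𝓞 F) ∈ S}} × Fin 1 =>
                  ((Real.sqrt (p.1.1.residueCard : ℝ) : ℝ) : ℂ) ^ ((p.2.1 + 1) * (1 - (p.2.1 + 1))) *
                    (∑ m, (A i m p.1.1).map (((p.1.1.residueCard : ℂ) ^ (-(s i m))) * ·)).esymm
                      (p.2.1 + 1)) φ =
              ∑ j, d j * MvPolynomial.eval
                (fun p : {w : HeightOneSpectrum (𝓞 E) //
                    w ∉ {w : HeightOneSpectrum (𝓞 E) | w.under (𝓞 F) ∈ S}} × Fin 1 =>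
                  ((Real.sqrt (p.1.1.residueCard : ℝ) : ℝ) : ℂ) ^ ((p.2.1 + 1) * (1 - (p.2.1 + 1))) *
                    (B j p.1.1).esymm (p.2.1 + 1)) φ := by
  intro F E _ _ _ _ _ _ _ _ μ _ P ν _ S _ hunr hram
  classical
  -- `χ = χ_π`; its base change `χ_E = χ ∘ N_{E/F}` is unitary and trivial on `ℝ_{>0}`
  have hu : (P.heckeCharacter.baseChange E).IsUnitary := P.isUnitary_heckeCharacter.baseChange E
  have h0 : ∀ t, P.heckeCharacter.baseChange E (posRealIdele E t) = 1 := fun t => by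
    rw [GaloisRepresentations.HeckeCharacter.baseChange_posRealIdele, P.heckeCharacter_posRealIdele]
  -- the lift `Π`: the line of `L²_cusp(GL_1(𝔸_E), ν 1)` with Hecke character `χ_E`
  obtain ⟨Q, hQχ, hfix⟩ :=
    CuspidalAutomorphicRepGL.exists_heckeCharacter_eq (μ := ν 1) (P.heckeCharacter.baseChange E) hu h0
  -- `χ` is unramified off `S`, `χ_E` off the places over `S`
  have hurF : ∀ v ∉ S, P.heckeCharacter.IsUnramifiedAt v := fun v hv =>
    GLOne.isUnramifiedAt_heckeCharacter P.isTopIrreducible (hram v hv)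
  have hurE : ∀ w : HeightOneSpectrum (𝓞 E), w.under (𝓞 F) ∉ S →
      (P.heckeCharacter.baseChange E).IsUnramifiedAt w := fun w hw =>
    P.heckeCharacter.isUnramifiedAt_baseChange (hurF _ hw) rfl
  -- the honest Satake family `α = {χ(ϖ_v)}` of `π` off `S`
  have hα : IsSatakeFamilyOf P S fun v => {P.heckeCharacter.valueAtUniformizer v} := by
    intro v hv
    obtain ⟨𝔫, h𝔫, hv𝔫, ϖ, α₀, hsat⟩ := hram v hv
    refine ⟨𝔫, h𝔫, hv𝔫, ϖ, ?_⟩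
    rw [hsat.eq_singleton_valueAtUniformizer P.isTopIrreducible h𝔫 hv𝔫] at hsat
    exact hsat
  -- the honest Satake family `A = {χ_E(ϖ_w)}` of `Π` off the places over `S`
  have hA : IsSatakeFamilyOf Q {w | w.under (𝓞 F) ∈ S}
      fun w => {(P.heckeCharacter.baseChange E).valueAtUniformizer w} := by
    intro w hw
    obtain ⟨𝔪, h𝔪, hw𝔪, hχ𝔪⟩ :=
      GaloisRepresentations.HeckeCharacter.exists_level_not_dvd_of_isUnramifiedAt 1 (hurE w hw)
    obtain ⟨f, hf, hf0⟩ := hfix (principalCongruenceLevel 1 E 𝔪) hχ𝔪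
    refine ⟨𝔪, h𝔪, hw𝔪, GaloisRepresentations.HeckeCharacter.uniformizer E w, ?_⟩
    have key := GLOne.hasSatakeParameterAt_of_mem_fixedVectors Q.isTopIrreducible hf hf0 w
      (GaloisRepresentations.HeckeCharacter.valued_uniformizer (K := E) w)
    have hval : ((GLOne.heckeCharacter Q.isTopIrreducible
        (localUnits w (GaloisRepresentations.HeckeCharacter.uniformizer E w)) : ℂˣ) : ℂ) =
        (P.heckeCharacter.baseChange E).valueAtUniformizer w := by
      change ((Q.heckeCharacter _ : ℂˣ) : ℂ) = _
      rw [hQχ, GaloisRepresentations.HeckeCharacter.valueAtUniformizer,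
        GaloisRepresentations.HeckeCharacter.localComponent_apply]
    rwa [hval] at key
  -- relation (1.1) at EVERY `w ∤ S`: `χ_E(ϖ_w) = χ(ϖ_v)^{f(w|v)}`
  have hrel : ∀ w : HeightOneSpectrum (𝓞 E), w.under (𝓞 F) ∉ S →
      (({P.heckeCharacter.valueAtUniformizer (w.under (𝓞 F))} : Multiset ℂ).map
          (· ^ w.asIdeal.inertiaDeg (𝓞 F))) =
        ∑ _m : Fin 1, (({(P.heckeCharacter.baseChange E).valueAtUniformizer w} : Multiset ℂ).map
          (((w.residueCard : ℂ) ^ (-((0 : ℂ)))) * ·)) := by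
    intro w hw
    -- the image `ϖ'` in `E_w` of the uniformizer `ϖ_v` of `F_v` is a uniformizer (`e(w|v) = 1`)
    set v : HeightOneSpectrum (𝓞 F) := w.under (𝓞 F) with hvdef
    haveI iw : w.asIdeal.LiesOver v.asIdeal := ⟨rfl⟩
    obtain ⟨cw, hc, -⟩ :=
      exists_localUnitsAbove E v (GaloisRepresentations.HeckeCharacter.uniformizer F v)
    have heIn : v.asIdeal.ramificationIdxIn (𝓞 E) = 1 :=
      GaloisRepresentations.ramificationIdxIn_eq_one_of_isUnramifiedIn (hunr v hw)
    have he' : v.asIdeal.ramificationIdx' w.asIdeal = 1 := by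
      rw [Ideal.ramificationIdx'_eq_ramificationIdx v.asIdeal w.asIdeal v.ne_bot,
        ← Ideal.ramificationIdxIn_eq_ramificationIdx v.asIdeal w.asIdeal (E ≃ₐ[F] E), heIn]
    have hfIn : v.asIdeal.inertiaDegIn (𝓞 E) = w.asIdeal.inertiaDeg (𝓞 F) :=
      Ideal.inertiaDegIn_eq_inertiaDeg v.asIdeal w.asIdeal (E ≃ₐ[F] E)
    have hϖ' : Valued.v ((cw w : (w.adicCompletion E)ˣ) : w.adicCompletion E) =
        WithZero.exp (-1 : ℤ) := by
      rw [hc w rfl, valued_adicCompletionOfLiesOver, he', pow_one,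
        GaloisRepresentations.HeckeCharacter.valued_uniformizer]
    -- `χ_E(ϖ_w) = χ_E(ϖ') = χ(N ϖ') = χ(ϖ_v)^{e f} = χ(ϖ_v)^f`
    have hval : (P.heckeCharacter.baseChange E).valueAtUniformizer w =
        P.heckeCharacter.valueAtUniformizer v ^ w.asIdeal.inertiaDeg (𝓞 F) := by
      rw [← GaloisRepresentations.HeckeCharacter.localComponent_eq_valueAtUniformizer (hurE w hw) hϖ',
        GaloisRepresentations.HeckeCharacter.localComponent_apply,
        GaloisRepresentations.HeckeCharacter.baseChange_localUnits E P.heckeCharacter v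
          (GaloisRepresentations.HeckeCharacter.uniformizer F v) cw hc rfl,
        heIn, one_mul, hfIn, Units.val_pow_eq_pow_val,
        GaloisRepresentations.HeckeCharacter.valueAtUniformizer,
        GaloisRepresentations.HeckeCharacter.localComponent_apply]
    rw [Fin.sum_univ_one, neg_zero, Complex.cpow_zero, Multiset.map_singleton,
      Multiset.map_singleton, one_mul, hval]
  -- one term on each side (`heckeCharacterIdentity_of_isobaricLiftFamily`)
  exact heckeCharacterIdentity_of_isobaricLiftFamily (n := 1) P S (M := Fin 1) (dM := fun _ => 1)
    (fun _ => Q) (fun _ => 0) (AM := fun _ w => {(P.heckeCharacter.baseChange E).valueAtUniformizer w})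
    (fun _ => Nat.one_pos) (by simp) (by simp) hα (fun _ => hA) hrel

/-- **The exact content of the named fact: weak base change in isobaric form, with relation (1.1)
at EVERY place off the prescribed `S` (PROVED equivalence).**  The named fact
`ArthurClozel1989_liftingIdentity_heckeCharacters` — the comparison (4.1) = (4.2) off `S` read as an
identity of finite combinations of characters of `ℋ_E^S` — holds if and only if, for every Galois
`E/F` of prime degree, `n ≥ 1`, automorphic measures `μ`, `ν_a`, cuspidal `π ⊂ L²(μ)` and finite `S`
off which `E/F` and `π` are unramified, there is an **isobaric weak base-change datum for `π` over
`E` off `S`**: finitely many cuspidal `Πₘ ⊂ L²_cusp(GL_{dₘ}(𝔸_E), ν_{dₘ})` (`dₘ ≥ 1`, `∑ dₘ = n`),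
shifts `sₘ ∈ ℂ` with `∑ dₘ sₘ = 0`, a Satake family `α` of `π` off `S`, Satake families `Aₘ` of the
`Πₘ` off the places over `S`, with `α(v)^{f(w|v)} = ⨆ₘ q_w^{-sₘ} Aₘ(w)` at every place `w ∣ v ∉ S`
of `E` — i.e. "there is a representation `Π` of `G(𝐀_E)`, occurring in (4.2), which is a weak lift of
`π` … by the theory of Eisenstein series … a subquotient of `Π₁ × Π₂ × ⋯ × Π_r`, `Πᵢ` cuspidal"
(op. cit. pp. 204–205), for the `S` of p. 203.  Forward: independence of the characters of `ℋ_E^S`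
(`exists_isobaricLiftFamily_of_heckeCharacter_identity`, `ArthurClozelWeakLiftingOffSProofs`);
backward: one term on each side (`heckeCharacterIdentity_of_isobaricLiftFamily`).  So the identity's
packaging (coefficients, pairwise distinct families of the `GL_n(𝔸_F)` side, the non-vanishing
`d_{j₀} ≠ 0`) carries no content beyond the existence of the lift; what remains unproved in the tree
is that existence for `n ≥ 2` (the twisted trace formula, Ch. 2 (17.8)); `n = 1` is
`ArthurClozel1989_liftingIdentity_heckeCharacters.rank_one`.
[cite: ArthurClozelAMS120, Ch. 3, Thm. 4.2 (a)–(b) and proof of (a), pp. 203–205, with (4.1), (4.2) and Ch. 2 (17.8)]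
[cite: LanglandsCorvallis1979Notion, Prop. 2] -/
theorem ArthurClozel1989_liftingIdentity_heckeCharacters_iff_forall_exists_isobaricLift :
    ArthurClozel1989_liftingIdentity_heckeCharacters ↔
      ∀ {n : ℕ} {F E : Type} [Field F] [NumberField F] [Field E] [NumberField E]
        [Algebra F E] [IsGalois F E], (Module.finrank F E).Prime → 0 < n →
        ∀ (μ : Measure (gl n F).automorphicQuotient) [(gl n F).IsAutomorphicMeasure μ]
          (P : CuspidalAutomorphicRepGL n F μ)
          (ν : (a : ℕ) → Measure (gl a E).automorphicQuotient)
          [∀ a, (gl a E).IsAutomorphicMeasure (ν a)]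
          (S : Set (HeightOneSpectrum (𝓞 F))), S.Finite →
          (∀ v ∉ S, Algebra.IsUnramifiedIn (𝓞 E) v.asIdeal) →
          (∀ v ∉ S, IsUnramifiedAt P.1 v) →
          ∃ (M : Type) (_ : Fintype M) (d : M → ℕ)
            (Q : ∀ m, CuspidalAutomorphicRepGL (d m) E (ν (d m))) (s : M → ℂ)
            (α : SatakeFamily F) (A : M → SatakeFamily E),
            (∀ m, 0 < d m) ∧ ∑ m, d m = n ∧ ∑ m, (d m : ℂ) * s m = 0 ∧
            IsSatakeFamilyOf P S α ∧
            (∀ m, IsSatakeFamilyOf (Q m) {w | w.under (𝓞 F) ∈ S} (A m)) ∧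
            ∀ w : HeightOneSpectrum (𝓞 E), w.under (𝓞 F) ∉ S →
              (α (w.under (𝓞 F))).map (· ^ w.asIdeal.inertiaDeg (𝓞 F)) =
                ∑ m, (A m w).map (((w.residueCard : ℂ) ^ (-(s m))) * ·) := by
  refine ⟨fun h n F E _ _ _ _ _ _ hℓ hn μ _ P ν _ S hS hunr hram => ?_,
    fun h n F E _ _ _ _ _ _ hℓ hn μ _ P ν _ S hS hunr hram => ?_⟩
  · -- forward: extract the datum from the identity by independence of characters
    obtain ⟨a, c, r, k, hk, hkn, Q, s, hs, A, hA, b, d, B, hB, hBinj, j₀, hd, α, hα, hBα, hid⟩ :=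
      h hℓ hn μ P ν S hS hunr hram
    exact exists_isobaricLiftFamily_of_heckeCharacter_identity P S c hk hkn Q s hs hA d B hB hBinj
      j₀ hd hα hBα hid
  · -- backward: a datum is an identity with one term on each side
    obtain ⟨M, _, d, Q, s, α, A, hd, hdn, hds, hα, hA, hrel⟩ := h hℓ hn μ P ν S hS hunr hram
    exact heckeCharacterIdentity_of_isobaricLiftFamily P S Q s hd hdn hds hα hA hrel

end Literature.NumberTheory.Automorphic

end
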